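import Mathlib
import Literature.Combinatorics.Additive.TripleProductProperty
import Summits.MatrixMultiplication.MatrixMultiplication.Theorems.SnSubsetDichotomyPolynomialSlackStubSplit

/-!
# `SnSubsetDichotomy.PolynomialSlack`, line `quotient-globalisation-by-pruning`: the exact count

The EXACT SOLUTION COUNT of a triple `S, T, U` with the triple product property
(crux `stmt-MatrixMultiplication-8306`, registered stub `stub_trivialSolutionCount` of
`Cruxes/PolynomialSlack/Lines/quotient-globalisation-by-pruning.lean`; also the dense core of the
route support `QuotientSetDeficit`, `stmt-MatrixMultiplication-8307`).  Write
`A = S⁻¹T := image₂ (fun s t => s⁻¹ * t) S T`, `B = T⁻¹U`, `C′ = S⁻¹U`.  The solutions of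
`a · b ∈ C′` with `(a, b) ∈ A × B` are EXACTLY the `|S||T||U|` trivial ones `(s⁻¹t)(t⁻¹u) = s⁻¹u`:

* the map `φ (s, t, u) = (s⁻¹t, t⁻¹u)` sends `S × T × U` into the solution set
  (`(s⁻¹t)(t⁻¹u) = s⁻¹u ∈ C′`);
* `φ` is injective on `S × T × U` (the pairwise part of the property: `injOn_quot_first` with the
  witness `u ∈ U`, then cancel `t⁻¹` in the second coordinate);
* `φ` is onto the solution set — THE place where the genuine three-fold condition is used: if
  `a = s⁻¹t`, `b = t′⁻¹u` and `a · b = s″⁻¹u″`, then `s″s⁻¹ · tt′⁻¹ · uu″⁻¹ = 1`, so the triple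
  product property gives `t = t′`, i.e. `(a, b) = φ (s, t, u)`.

Hence the count is `|S × T × U| = |S||T||U|` (`Finset.card_bij`, `Finset.card_product`); empty
sets need no special casing.  Proved for an arbitrary group and specialised to `S_n`.
-/

-- `Summit.<Summit>.<Problem>` is the tree's mandated summit-side namespace; for this
-- single-conjunct summit the two coincide, so the file silences `dupNamespace`.
set_option linter.dupNamespace false

open Finset
open Literature.Combinatorics.Additive (TripleProductProperty)

namespace Summit.MatrixMultiplication.MatrixMultiplication.Theorems.PolynomialSlack

section Group

variable {G : Type*} [Group G] [DecidableEq G] {S T U : Finset G}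

/-- The trivial solutions are solutions: for `s ∈ S`, `t ∈ T`, `u ∈ U` the pair
`(s⁻¹t, t⁻¹u)` lies in `S⁻¹T × T⁻¹U` and its product `s⁻¹u` lies in `S⁻¹U`. [folklore] -/
theorem trivialSolution_mem {s t u : G} (hs : s ∈ S) (ht : t ∈ T) (hu : u ∈ U) :
    (s⁻¹ * t, t⁻¹ * u) ∈
      (Finset.image₂ (fun s t => s⁻¹ * t) S T ×ˢ Finset.image₂ (fun t u => t⁻¹ * u) T U).filter
        (fun ab => ab.1 * ab.2 ∈ Finset.image₂ (fun s u => s⁻¹ * u) S U) := by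
  simp only [Finset.mem_filter, Finset.mem_product, Finset.mem_image₂]
  refine ⟨⟨⟨s, hs, t, ht, rfl⟩, ⟨t, ht, u, hu, rfl⟩⟩, ⟨s, hs, u, hu, ?_⟩⟩
  group

/-- Every solution is trivial (the genuine three-fold triple product property): if `s ∈ S`,
`t, t′ ∈ T`, `u ∈ U` and `(s⁻¹t)(t′⁻¹u) ∈ S⁻¹U`, then `t = t′` (from `(s⁻¹t)(t′⁻¹u) = s″⁻¹u″` one
gets the word `s″s⁻¹ · tt′⁻¹ · uu″⁻¹ = 1`). [folklore] -/
theorem eq_of_quot_mul_quot_mem (h : TripleProductProperty S T U) {s t t' u : G} (hs : s ∈ S)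
    (ht : t ∈ T) (ht' : t' ∈ T) (hu : u ∈ U)
    (hmem : s⁻¹ * t * (t'⁻¹ * u) ∈ Finset.image₂ (fun s u => s⁻¹ * u) S U) : t = t' := by
  obtain ⟨s'', hs'', u'', hu'', he⟩ := Finset.mem_image₂.1 hmem
  have key : s'' * s⁻¹ * (t * t'⁻¹) * (u * u''⁻¹) = 1 := by
    calc s'' * s⁻¹ * (t * t'⁻¹) * (u * u''⁻¹) = s'' * (s⁻¹ * t * (t'⁻¹ * u)) * u''⁻¹ := by group
      _ = s'' * (s''⁻¹ * u'') * u''⁻¹ := by rw [he]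
      _ = 1 := by group
  exact (h s'' hs'' s hs t ht t' ht' u hu u'' hu'' key).2.1

/-- **The exact solution count** in an arbitrary group: for a triple `S, T, U` with the triple
product property, the number of pairs `(a, b) ∈ S⁻¹T × T⁻¹U` with `ab ∈ S⁻¹U` is exactly
`|S||T||U|` — the map `(s, t, u) ↦ (s⁻¹t, t⁻¹u)` is a bijection from `S × T × U` onto the solution
set (into: `trivialSolution_mem`; injective: `injOn_quot_first` and cancellation; onto:
`eq_of_quot_mul_quot_mem`). [folklore] -/
theorem card_filter_quot_mul_quot_mem (h : TripleProductProperty S T U) :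
    ((Finset.image₂ (fun s t => s⁻¹ * t) S T ×ˢ Finset.image₂ (fun t u => t⁻¹ * u) T U).filter
        (fun ab => ab.1 * ab.2 ∈ Finset.image₂ (fun s u => s⁻¹ * u) S U)).card =
      S.card * T.card * U.card := by
  rw [← Finset.card_product, ← Finset.card_product]
  symm
  refine Finset.card_bij (fun (x : (G × G) × G) _ => (x.1.1⁻¹ * x.1.2, x.1.2⁻¹ * x.2))
    ?_ ?_ ?_
  · -- into the solution set
    rintro ⟨⟨s, t⟩, u⟩ hx
    simp only [Finset.mem_product] at hx
    exact trivialSolution_mem hx.1.1 hx.1.2 hx.2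
  · -- injective
    rintro ⟨⟨s, t⟩, u⟩ hx ⟨⟨s', t'⟩, u'⟩ hx' he
    simp only [Finset.mem_product] at hx hx'
    simp only [Prod.mk.injEq] at he
    obtain ⟨he₁, he₂⟩ := he
    have hst : (s, t) = (s', t') :=
      injOn_quot_first h ⟨u, hx.2⟩ (Set.mk_mem_prod (Finset.mem_coe.2 hx.1.1)
        (Finset.mem_coe.2 hx.1.2)) (Set.mk_mem_prod (Finset.mem_coe.2 hx'.1.1)
        (Finset.mem_coe.2 hx'.1.2)) he₁
    simp only [Prod.mk.injEq] at hst
    obtain ⟨rfl, rfl⟩ := hst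
    obtain rfl : u = u' := mul_left_cancel he₂
    rfl
  · -- onto the solution set
    rintro ⟨a, b⟩ hab
    simp only [Finset.mem_filter, Finset.mem_product, Finset.mem_image₂] at hab
    obtain ⟨⟨⟨s, hs, t, ht, rfl⟩, ⟨t', ht', u, hu, rfl⟩⟩, hmem⟩ := hab
    obtain rfl : t = t' := eq_of_quot_mul_quot_mem h hs ht ht' hu (Finset.mem_image₂.2 hmem)
    exact ⟨((s, t), u), Finset.mem_product.2 ⟨Finset.mem_product.2 ⟨hs, ht⟩, hu⟩, rfl⟩

end Group

/-- **Stub `stub_trivialSolutionCount` — the exact solution count** (line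
`quotient-globalisation-by-pruning` of crux `PolynomialSlack`; dense core of route support
`QuotientSetDeficit`).  For a triple `S, T, U ⊆ S_n` with the triple product property, the
solutions of `a · b ∈ S⁻¹U` with `(a, b) ∈ S⁻¹T × T⁻¹U` are exactly the `|S||T||U|` trivial ones
`(s⁻¹t)(t⁻¹u) = s⁻¹u` (`card_filter_quot_mul_quot_mem` specialised to `S_n`). [folklore] -/
theorem stub_trivialSolutionCount :
    ∀ (n : ℕ) (S T U : Finset (Equiv.Perm (Fin n))), TripleProductProperty S T U →
      ((Finset.image₂ (fun s t => s⁻¹ * t) S T ×ˢ Finset.image₂ (fun t u => t⁻¹ * u) T U).filter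
          (fun ab => ab.1 * ab.2 ∈ Finset.image₂ (fun s u => s⁻¹ * u) S U)).card =
        S.card * T.card * U.card :=
  fun _ _ _ _ h => card_filter_quot_mul_quot_mem h

end Summit.MatrixMultiplication.MatrixMultiplication.Theorems.PolynomialSlack
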